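import Summits.HodgeConjecture.CorCM.HypLiu418.A3Liu418GSFrobeniusOfThmD6Pieces
import HarnessLib

/-!
# GS-6 from [Liu2021, Thm. D.6 (1)] for one curve — FOLD module (§3: `DecompositionAtFaceAdapted` from frame independence (node (T)) and the see-saw character (node R))

PRE-SPLIT (director hodgecm-mathlib s168 (1)(d) ∕ s177 ∕ s178 (3), A-plan1 (g13) 19:14:52Z «every filed piece ≤ 250 check-node
CPU-s»; cutter A-p18 (g10)): A-p17 (g7/g8)՚s report-first `A3Liu418GSFrobeniusOfThmD6` b02ca771e6e9ad41 (349 l., ≈ 390 CPU-s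
synchronous on a check node) is filed as the 3-module chain `A3Liu418GSFrobeniusOfThmD6Pieces` (§1–§2) →
`A3Liu418GSFrobeniusOfThmD6Fold` (§3) → `A3Liu418GSFrobeniusOfThmD6` (§4, the head, module name KEPT for the β registry import);
every declaration (statement, proof, docstring, `set_option … in` line) is BYTE-IDENTICAL to b02ca771, same namespace
`Summit.HodgeConjecture.CorCM.Lines.A3Liu418`, unchanged fully-qualified names; the file-level `open` block is repeated per module.

This module: §3 (F1) `complexConj_eq_self_of_im_eq_zero`, (F3) `finAdelicCastV_gsAdaptedTransport_φGS`, (F4) THE FOLD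
`DecompositionAtFaceAdapted_of_stubT`, (F5) the exit certificate `frobeniusActsByGS_of_thmD6OneCurveCUF_of_stubT`, over the PIECES module
`A3Liu418GSFrobeniusOfThmD6Pieces` — see the head module `A3Liu418GSFrobeniusOfThmD6` for the full description.
THEOREMS ONLY.  HC_CM is proved only modulo the 7 printed citations until rung 0 closes; this file discharges none of them.

## References
* [Liu2021] Y. Liu, *Fourier–Jacobi cycles and arithmetic relative trace formula* (FJcycle.tex), Camb. J. Math. 9 (2021) = arXiv:2102.11518:
  Thm. 4.15 proof p. 51 (l. 2193–2212); §4.2 (l. 2162–2165); App. D: Rem. D.5 p. 131, Thm. D.6 (1) p. 132 (l. 5433–5443).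
-/

set_option autoImplicit false

noncomputable section

open scoped TensorProduct Matrix NumberField Kronecker ComplexOrder
open NumberField NumberField.InfinitePlace IsDedekindDomain
open Summit.HodgeConjecture.CorCM.Model
open Summit.HodgeConjecture.CorCM.Model.HComp Summit.HodgeConjecture.CorCM.HComp
open Literature.AlgebraicGeometry.Motives (CMType)
open Literature.AlgebraicGeometry.ShimuraVarieties.UnitaryCanonicalModel
open Literature.NumberTheory.Automorphic Literature.NumberTheory.Automorphic.UnitaryGroup
open Literature.NumberTheory.Automorphic.IdeleClassGroup
open Literature.NumberTheory.Automorphic.Liu2021 Literature.NumberTheory.Automorphic.Liu2021.AppendixC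
open Literature.NumberTheory.GaloisRepresentations
open Literature.AlgebraicGeometry.Liu2021 (IsAdmissibleElement)
open Literature.RepresentationTheory.Liu2021
open Literature.RepresentationTheory.HarrisKudlaSweet1996
open Literature.NumberTheory.Weil1964
open Literature.NumberTheory.GelbartRogawski1991
open Literature.NumberTheory.GelbartRogawski1991.UnitaryDualPair
open Literature.NumberTheory.GelbartRogawski1991.UnitaryDualPair.WeilCoinv
open Literature.NumberTheory.GelbartRogawski1991.UnitaryDualPair.LocalSplitting
open Literature.NumberTheory.Automorphic.Liu2021.Def411WeilCarriersDoubling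
open Literature.NumberTheory.Automorphic.Liu2021.Def411WeilCarriers (TW JW JW_eq isSymm_TW isUnit_det_TW Rep Eps epsOf Chi)
open Literature.NumberTheory.Automorphic.Liu2021.Def411WeilCarriers (rhoVAtLine)

namespace Summit.HodgeConjecture.CorCM.Lines.A3Liu418

/-! ## §3 The fold: `DecompositionAtFaceAdapted` from frame independence (node (T)) and the see-saw character (node R) -/

section Fold

open scoped TensorProduct Matrix NumberField
open NumberField
open Summit.HodgeConjecture.CorCM.Model
open Literature.AlgebraicGeometry.Motives (CMType)
open Literature.AlgebraicGeometry.ShimuraVarieties Literature.AlgebraicGeometry.ShimuraVarieties.UnitaryCanonicalModel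
open Literature.NumberTheory.Automorphic Literature.NumberTheory.Automorphic.UnitaryGroup
open Literature.NumberTheory.Automorphic.IdeleClassGroup
open Literature.NumberTheory.Automorphic.Liu2021 Literature.NumberTheory.Automorphic.Liu2021.AppendixC
open Literature.NumberTheory.GelbartRogawski1991 Literature.NumberTheory.GelbartRogawski1991.UnitaryDualPair
open Literature.NumberTheory.GelbartRogawski1991.UnitaryDualPair.WeilCoinv
open Literature.NumberTheory.Automorphic.Liu2021.Def411WeilCarriersDoubling
open Literature.NumberTheory.Automorphic.Liu2021.Def411WeilCarriers (TW JW JW_eq isSymm_TW isUnit_det_TW Rep Eps epsOf Chi locF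
  omegaAtLine rhoVAtLine rhoAtLine lineChar)
open Literature.RepresentationTheory Literature.RepresentationTheory.TwistedCoinv
open Literature.AlgebraicGeometry.Liu2021 (IsAdmissibleElement)
open HodgeCM.Model HodgeCM.Model.LiuIndex
open Summit.HodgeConjecture.CorCM.D2Bridge.AdapterMuConj (muConj)
open Summit.HodgeConjecture.CorCM.Model.HComp Summit.HodgeConjecture.CorCM.HComp
open Literature.NumberTheory.GaloisRepresentations
open Literature.RepresentationTheory.Liu2021
open Literature.RepresentationTheory.HarrisKudlaSweet1996
open Literature.NumberTheory.Weil1964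
open Literature.NumberTheory.GelbartRogawski1991.UnitaryDualPair.LocalSplitting
open Summit.HodgeConjecture.CorCM.Transposition.OmegaTransport (realUnit)
open HodgeCM.Model.ArchSideTerm (e₁)

/-! ### (F1) real image ⇒ `c`-fixed -/

/-- (F1) An element of the CM field whose image under the distinguished embedding `ι₁` is real is fixed by complex conjugation
(`ι₁ ∘ c = conj ∘ ι₁`, ★ `embedding_cmConjRingHom`, and injectivity of `ι₁`). [cite: BergeronMillsonMoeglin2016Balls, Part 2 §1.1] -/
theorem complexConj_eq_self_of_im_eq_zero (L : CMField) (τ : (L : Type) →+* ℂ) (x : (L : Type)) (hx : (τ x).im = 0) :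
    IsCMField.complexConj (L : Type) x = x := by
  have h : cmConjRingHom (L : Type) x = x :=
    τ.injective (by rw [embedding_cmConjRingHom, Complex.conj_eq_iff_im, hx])
  exact h

/-! ### (F3) the element junction `ι_{D′}(φGS u) = (g⋆⁻¹·u, 1)` through the append/fin-sum cast -/

/-- (F3) Along the adapted frame `D′ = B·(g⋆ ⊕ 1)`, the face embedding `φGS u` read in `U(diag (dJ ‖ a⁻¹J⊥₀₀))(𝔸_f)` and cast to
`U(diag dJ ⊕ᶠ diag (a⁻¹J⊥₀₀))(𝔸_f)` is the literal block diagonal `((finAdelicCongr g⋆)⁻¹ u, 1)` ((J3c) + the `rfl` coercion lemmas).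
[cite: Liu2021, proof of Thm. 4.15 (FJcycle.tex l. 2193–2203)] [cite: Kudla1984, §1] -/
theorem finAdelicCastV_gsAdaptedTransport_φGS (L : Type) [Field L] [NumberField L] [IsCMField L] (Jstar : Matrix (Fin 2) (Fin 2) L)
    (Jperp : Matrix (Fin 1) (Fin 1) L) (H : Matrix (Fin 3) (Fin 3) L) (B : GL (Fin 3) L) {a : L} (ha : a ≠ 0)
    (hB : formCongr ((IsCMField.complexConj L : L ≃ₐ[↥(maximalRealSubfield L)] L) : L →+* L) B (a • H) = finSum 2 1 Jstar Jperp)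
    (gstar : GL (Fin 2) L) (dJ : Fin 2 → L)
    (hg : formCongr ((IsCMField.complexConj L : L ≃ₐ[↥(maximalRealSubfield L)] L) : L →+* L) gstar (a⁻¹ • Jstar) = Matrix.diagonal dJ)
    (u : ↥(finAdelic (↥(maximalRealSubfield L)) L (IsCMField.complexConj L) 2 Jstar)) :
    finAdelicCastV (↥(maximalRealSubfield L)) L (IsCMField.complexConj L) _ (finSum_diagonal_append dJ ![a⁻¹ * Jperp 0 0]).symm
        (gsAdaptedTransport L Jstar Jperp H B ha hB gstar dJ hg (φGS L Jstar Jperp H B ha hB u)) =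
      finAdelicBlockDiag (↥(maximalRealSubfield L)) L (IsCMField.complexConj L) 2 1 (Matrix.diagonal dJ) (Matrix.diagonal ![a⁻¹ * Jperp 0 0])
        ((finAdelicCongr (↥(maximalRealSubfield L)) L (IsCMField.complexConj L) gstar (inv_ne_zero ha) hg).symm u, 1) := by
  apply Subtype.ext
  rw [coe_finAdelicCastV, coe_gsAdaptedTransport_φGS, coe_finAdelicBlockDiag]
  rfl

/-! ### (F4) the fold -/

set_option maxHeartbeats 8000000 in
/-- **THE FINAL FOLD — `DecompositionAtFaceAdapted` from node (T) (`chiSplittingFrameTransport`) and node R (`seesawCharChiSplittingLineTrivial`)**: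
for every face prefix and admissible label `ε = epsOf e`, the frame choice (`gsFrame_exists_diagFrame`) gives `(g⋆, dJ)`; the adapted frame is
`(dJ ‖ a′⁻¹J⊥₀₀, ι_{D′})`; the transport `(Ψ, hΨ)` is `exists_faceTransport_of_stubT hT`; the curve Weil line datum is `r_a`; the `H¹`-side
projectors are the occurring central-weight projections (`OccWeight`, `occProj`, joint injectivity, Galois commutation), the labels
`(εc, χc) = (epsOf (2i)⁻¹ (−e), occChi)`; the multiplicity modules, the maps `q i` and the factorisation are the G2c plug at the split datum
`diag dJ ⊕ᶠ diag (a′⁻¹J⊥₀₀)` (`exists_plugTail`, with `hχV` from node R and `θ := (finAdelicCongr g⋆)⁻¹` fixing the centre) behind the face cast.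
[cite: Liu2021, Thm. 4.15 proof l. 2199–2212; Rem. D.5; Thm. D.6 (1)] [cite: GelbartRogawski1991, §3.1 Prop. 3.1.1 p. 455] -/
theorem DecompositionAtFaceAdapted_of_stubT (hT : chiSplittingFrameTransport) (hR : seesawCharChiSplittingLineTrivial) :
    DecompositionAtFaceAdapted := by
  intro hDel F _ ι₁ V a Φ hΦ ν hν hw ℓ _ ι' Jstar K₀ S hU7ₛ hLQ h4 isoₛ Jperp B a' ha hB hτa hτa' hpos ε hadm χ
  obtain ⟨e, he, rfl⟩ := hadm
  -- (F1): `a′` and `J⊥₀₀` are `c`-fixed; `J⊥₀₀ ≠ 0` (A-p07's frame lemmas at the CorCM spelling of `V`)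
  have ha' : IsCMField.complexConj (F : Type) a' = a' :=
    complexConj_eq_self_of_im_eq_zero ⟨HodgeCM.CMField.K F⟩ ι₁ a' hτa'
  have hJ : IsCMField.complexConj (F : Type) (Jperp 0 0) = Jperp 0 0 :=
    complexConj_eq_self_of_im_eq_zero ⟨HodgeCM.CMField.K F⟩ ι₁ (Jperp 0 0)
      (gsFrame_im_subformRight_eq_zero
        (⟨HodgeCM.HermSpace3.Hm V, HodgeCM.HermSpace3.isHermitian V, HodgeCM.HermSpace3.signature_ι₁ V, HodgeCM.HermSpace3.posDef_of_ne V⟩ :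
          HermSpace3 ⟨HodgeCM.CMField.K F⟩ ι₁) Jstar Jperp B hB hτa')
  have hJ0 : Jperp 0 0 ≠ 0 :=
    gsFrame_subformRight_ne_zero
      (⟨HodgeCM.HermSpace3.Hm V, HodgeCM.HermSpace3.isHermitian V, HodgeCM.HermSpace3.signature_ι₁ V, HodgeCM.HermSpace3.posDef_of_ne V⟩ :
        HermSpace3 ⟨HodgeCM.CMField.K F⟩ ι₁) Jstar Jperp B ha hB
  -- frame choice (A-p07): `g⋆` takes `a′⁻¹J⋆` to a real non-zero diagonal `dJ` with the printed signature clause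
  obtain ⟨gstar, dJ, hdJ, hdJ0, hg, hsig1, hsig2⟩ :=
    gsFrame_exists_diagFrame
      (⟨HodgeCM.HermSpace3.Hm V, HodgeCM.HermSpace3.isHermitian V, HodgeCM.HermSpace3.signature_ι₁ V, HodgeCM.HermSpace3.posDef_of_ne V⟩ :
        HermSpace3 ⟨HodgeCM.CMField.K F⟩ ι₁) Jstar Jperp B ha hB hτa hτa' hpos h4
  -- the face transport from node (T)
  obtain ⟨Ψ, hΨ⟩ := exists_faceTransport_of_stubT hT hDel F V a Φ ν hν Jstar Jperp B a' ha hB ha' hJ hJ0 gstar dJ hdJ hdJ0 hg e χ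
  refine ⟨gstar, dJ, hdJ, hdJ0, hg, ⟨hsig1, hsig2⟩, gsAdaptedDiag (F : Type) Jperp a' dJ, gsAdaptedDiag_real (F : Type) Jperp dJ hdJ ha' hJ,
    gsAdaptedDiag_ne (F : Type) Jperp ha dJ hdJ0 hJ0, gsAdaptedTransport (F : Type) Jstar Jperp (HodgeCM.HermSpace3.Hm V) B ha hB gstar dJ hg,
    (UVat hDel F V a Φ (gsAdaptedDiag (F : Type) Jperp a' dJ) (gsAdaptedDiag_real (F : Type) Jperp dJ hdJ ha' hJ)
          (gsAdaptedDiag_ne (F : Type) Jperp ha dJ hdJ0 hJ0)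
          (gsAdaptedTransport (F : Type) Jstar Jperp (HodgeCM.HermSpace3.Hm V) B ha hB gstar dJ hg)).epsOf e,
    ⟨χ.1, χ.2⟩, Ψ, hΨ, rFace F a,
    OccWeight (F := ⟨HodgeCM.CMField.K F⟩) S hU7ₛ hLQ h4 isoₛ ℓ,
    occProj (F := ⟨HodgeCM.CMField.K F⟩) S hU7ₛ hLQ h4 isoₛ ℓ,
    eq_zero_of_forall_occProj_eq_zero (F := ⟨HodgeCM.CMField.K F⟩) S hU7ₛ hLQ h4 isoₛ ℓ,
    occProj_baseChange_towerRep (F := ⟨HodgeCM.CMField.K F⟩) S hU7ₛ hLQ h4 isoₛ ℓ,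
    fun _ => Def411WeilCarriers.epsOf ↥(maximalRealSubfield (F : Type)) (imagUnitSq (F : Type)) (F : Type)
      (2 * imagUnit (HodgeCM.CMField.K F))⁻¹ (-e),
    fun i => occChi (F := ⟨HodgeCM.CMField.K F⟩) S hU7ₛ hLQ h4 isoₛ ℓ ι' i, fun _ => ⟨e, he, rfl⟩, ?_⟩
  -- the real non-zero complement scalar `a′⁻¹J⊥₀₀`
  have hdperp : ∀ i, IsCMField.complexConj (F : Type) ((![a'⁻¹ * Jperp 0 0] : Fin 1 → (F : Type)) i) = (![a'⁻¹ * Jperp 0 0] : Fin 1 → (F : Type)) i := by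
    intro i
    fin_cases i
    show IsCMField.complexConj (F : Type) (a'⁻¹ * Jperp 0 0) = a'⁻¹ * Jperp 0 0
    rw [map_mul, map_inv₀, ha', hJ]
  have hdperp0 : ∀ i, (![a'⁻¹ * Jperp 0 0] : Fin 1 → (F : Type)) i ≠ 0 := by
    intro i
    fin_cases i
    exact mul_ne_zero (inv_ne_zero ha) hJ0
  -- (F2) the frame transport `θ := (finAdelicCongr g⋆)⁻¹` fixes the centre (A-p13 `finAdelicCongr_finAdelicCenter`)
  have hθ : ∀ z : ↥(finAdelicOne ↥(maximalRealSubfield (F : Type)) (F : Type) (IsCMField.complexConj (F : Type))),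
      (finAdelicCongr ↥(maximalRealSubfield (F : Type)) (F : Type) (IsCMField.complexConj (F : Type)) gstar (inv_ne_zero ha) hg).symm.toMonoidHom (finAdelicCenter ↥(maximalRealSubfield (F : Type)) (F : Type) (IsCMField.complexConj (F : Type)) 2 Jstar z) = finAdelicCenter ↥(maximalRealSubfield (F : Type)) (F : Type) (IsCMField.complexConj (F : Type)) 2 (Matrix.diagonal dJ) z := by
    intro z
    rw [← finAdelicCongr_finAdelicCenter ↥(maximalRealSubfield (F : Type)) (F : Type) (IsCMField.complexConj (F : Type)) 2 gstar
      (inv_ne_zero ha) hg z]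
    exact (finAdelicCongr ↥(maximalRealSubfield (F : Type)) (F : Type) (IsCMField.complexConj (F : Type)) gstar (inv_ne_zero ha) hg).symm_apply_apply _
  -- THE FACE CAST (A-p10 (g9) `exists_omegaFaceCast`, the cast elaborated CLOSED inside): `ω_{D′}(ν,ε′,χ′) ≃ Coinv(split datum)`,
  -- intertwining `ω_{D′} ∘ φGS` with `ω_χ ∘ (· ⊕ᶠ 1) ∘ (finAdelicCongr g⋆)⁻¹`
  obtain ⟨C, hC⟩ := exists_omegaFaceCast hDel F V a Φ ν hν Jstar Jperp B a' ha hB ha' hJ hJ0 gstar dJ hdJ hdJ0 hg hdperp hdperp0 e χ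
    (faceLine F a e) rfl
  -- THE PLUG TAIL `(M, q, hfac)` from the generic `exists_plugTail` at the split datum, behind the cast
  obtain ⟨M, q, hfac⟩ := exists_plugTail (F := ⟨HodgeCM.CMField.K F⟩) S hU7ₛ hLQ h4 isoₛ ℓ ι' 2 1 e₁ (finProdFinEquiv : Fin 2 × Fin 1 ≃ Fin (2 * 1)) (finProdFinEquiv : Fin 1 × Fin 1 ≃ Fin (1 * 1))
    (Matrix.diagonal dJ) (Matrix.diagonal ![a'⁻¹ * Jperp 0 0]) (complexConj_imagUnit F) (imagUnit_ne_zero F) (imagUnit_mul_self F) (realDiagonal_isSymm F dJ hdJ) (realDiagonal_isSymm F _ hdperp) (isUnit_det_realDiagonal F dJ hdJ hdJ0) (isUnit_det_realDiagonal F _ hdperp hdperp0) (isUnit_det_finSum_realDiagonal F dJ ![a'⁻¹ * Jperp 0 0] hdJ hdperp hdJ0 hdperp0) (realDiagonal_map F dJ hdJ).symm (realDiagonal_map F _ hdperp).symm (faceLine F a e)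
    (isCompatible_chiSplittingSum (HodgeCM.CMField.K F) e₁ dJ hdJ hdJ0 ![a'⁻¹ * Jperp 0 0] hdperp hdperp0 (toHeckeCharacter (F : Type) (galConj (IsCMField.complexConj (F : Type)) ν)) (isUnitary_toHeckeCharacter (F : Type) (galConj (IsCMField.complexConj (F : Type)) ν)) ((isOscillatorChar_toHeckeCharacter_iff (galConj (IsCMField.complexConj (F : Type)) ν)).mpr hν.galConj) (TW ↥(maximalRealSubfield (F : Type)) (faceLine F a e)) (isSymm_TW ↥(maximalRealSubfield (F : Type)) (faceLine F a e)) (isUnit_det_TW ↥(maximalRealSubfield (F : Type)) (faceLine F a e)) (JW ↥(maximalRealSubfield (F : Type)) (F : Type) (faceLine F a e)) (JW_eq ↥(maximalRealSubfield (F : Type)) (F : Type) (faceLine F a e))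
        (isSymm_finSum (realDiagonal_isSymm F dJ hdJ) (realDiagonal_isSymm F _ hdperp))
        (isUnit_det_finSum_realDiagonal F dJ ![a'⁻¹ * Jperp 0 0] hdJ hdperp hdJ0 hdperp0)
        (finSum_eq_map_finSum ↥(maximalRealSubfield (F : Type)) (F : Type) 2 1 (Matrix.diagonal dJ) (Matrix.diagonal ![a'⁻¹ * Jperp 0 0])
          (realDiagonal_map F dJ hdJ).symm (realDiagonal_map F _ hdperp).symm))
    (hsChiGS ⟨HodgeCM.CMField.K F⟩ finProdFinEquiv dJ hdJ hdJ0 (toHeckeCharacter (F : Type) (galConj (IsCMField.complexConj (F : Type)) ν)) (isUnitary_toHeckeCharacter (F : Type) (galConj (IsCMField.complexConj (F : Type)) ν)) ((isOscillatorChar_toHeckeCharacter_iff (galConj (IsCMField.complexConj (F : Type)) ν)).mpr hν.galConj))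
    (isCompatible_chiSplittingLine (HodgeCM.CMField.K F) (finProdFinEquiv : Fin 1 × Fin 1 ≃ Fin (1 * 1)) ![a'⁻¹ * Jperp 0 0] hdperp hdperp0 (toHeckeCharacter (F : Type) (galConj (IsCMField.complexConj (F : Type)) ν)) (isUnitary_toHeckeCharacter (F : Type) (galConj (IsCMField.complexConj (F : Type)) ν)) ((isOscillatorChar_toHeckeCharacter_iff (galConj (IsCMField.complexConj (F : Type)) ν)).mpr hν.galConj) (TW ↥(maximalRealSubfield (F : Type)) (faceLine F a e)) (isSymm_TW ↥(maximalRealSubfield (F : Type)) (faceLine F a e)) (isUnit_det_TW ↥(maximalRealSubfield (F : Type)) (faceLine F a e)) (JW ↥(maximalRealSubfield (F : Type)) (F : Type) (faceLine F a e)) (JW_eq ↥(maximalRealSubfield (F : Type)) (F : Type) (faceLine F a e)))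
    (fun g₁ => hR (HodgeCM.CMField.K F) e₁ (finProdFinEquiv : Fin 2 × Fin 1 ≃ Fin (2 * 1)) (finProdFinEquiv : Fin 1 × Fin 1 ≃ Fin (1 * 1)) dJ hdJ hdJ0 ![a'⁻¹ * Jperp 0 0] hdperp hdperp0 (toHeckeCharacter (F : Type) (galConj (IsCMField.complexConj (F : Type)) ν)) (isUnitary_toHeckeCharacter (F : Type) (galConj (IsCMField.complexConj (F : Type)) ν)) ((isOscillatorChar_toHeckeCharacter_iff (galConj (IsCMField.complexConj (F : Type)) ν)).mpr hν.galConj) (TW ↥(maximalRealSubfield (F : Type)) (faceLine F a e)) (isSymm_TW ↥(maximalRealSubfield (F : Type)) (faceLine F a e)) (isUnit_det_TW ↥(maximalRealSubfield (F : Type)) (faceLine F a e)) (JW ↥(maximalRealSubfield (F : Type)) (F : Type) (faceLine F a e)) (JW_eq ↥(maximalRealSubfield (F : Type)) (F : Type) (faceLine F a e)) g₁)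
    (⟨χ.1, χ.2⟩ : Chi ↥(maximalRealSubfield (F : Type)) (F : Type) (IsCMField.complexConj (F : Type))) (finAdelicCongr ↥(maximalRealSubfield (F : Type)) (F : Type) (IsCMField.complexConj (F : Type)) gstar (inv_ne_zero ha) hg).symm.toMonoidHom hθ
    (((UVat hDel F V a Φ (gsAdaptedDiag (F : Type) Jperp a' dJ) (gsAdaptedDiag_real (F : Type) Jperp dJ hdJ ha' hJ)
          (gsAdaptedDiag_ne (F : Type) Jperp ha dJ hdJ0 hJ0)
          (gsAdaptedTransport (F : Type) Jstar Jperp (HodgeCM.HermSpace3.Hm V) B ha hB gstar dJ hg)).rho ν hν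
          ((UVat hDel F V a Φ (gsAdaptedDiag (F : Type) Jperp a' dJ) (gsAdaptedDiag_real (F : Type) Jperp dJ hdJ ha' hJ)
          (gsAdaptedDiag_ne (F : Type) Jperp ha dJ hdJ0 hJ0)
          (gsAdaptedTransport (F : Type) Jstar Jperp (HodgeCM.HermSpace3.Hm V) B ha hB gstar dJ hg)).epsOf e) ⟨χ.1, χ.2⟩).comp
        (φGS (F : Type) Jstar Jperp (HodgeCM.HermSpace3.Hm V) B ha hB))
    C hC
  exact ⟨M, q, hfac⟩

/-! ### (F5) the exit certificate -/

/-- **EXIT CERTIFICATE of the GS-6 (β) glue (phase A)**: `frobeniusActsByGS` from the hoisted fact `thmD6OneCurveCUF` ([Liu2021, Thm. D.6 (1)]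
for one curve), node (T) `chiSplittingFrameTransport` (frame independence of `ω(μ,ε,χ)`) and node R `seesawCharChiSplittingLineTrivial`.
[cite: Liu2021, Thm. 4.15 proof l. 2199–2212; Thm. D.6 (1) p. 132] -/
theorem frobeniusActsByGS_of_thmD6OneCurveCUF_of_stubT (hD6 : thmD6OneCurveCUF) (hT : chiSplittingFrameTransport)
    (hR : seesawCharChiSplittingLineTrivial) : frobeniusActsByGS :=
  frobeniusActsByGS_of_pieces₃ hD6 (DecompositionAtFaceAdapted_of_stubT hT hR)

end Fold

end Summit.HodgeConjecture.CorCM.Lines.A3Liu418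

end
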